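import Literature.NumberTheory.LFunctions.StarkHadamardPositivity
import Mathlib.Analysis.Complex.PhragmenLindelof
import HarnessLib

/-!
# Odlyzko's zero-sum inequalities for symmetric entire functions (the differencing method)

Topic `Literature/NumberTheory/LFunctions`, namespace `Literature.NumberTheory.LFunctions.Odlyzko1977`
(grouping namespace named after A. M. Odlyzko, *Lower bounds for discriminants of number fields. II*,
Tôhoku Math. J. 29 (1977) 209–216, whose method — eqs. (8)–(13) — this file abstracts; see also
part I, Acta Arith. 29 (1976) 275–297, §2). Everything here is PROVED; no definitions, no named facts.

The printed argument [Odlyzko1977, pp. 212–214]: starting from Stark's identity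
`log A = G(σ) − 1/σ − 1/(σ−1) + Z(σ) + Σ'_ρ 1/(σ−ρ)` (the Hadamard factorisation of the completed
zeta function), "our main goal will be to obtain a lower bound for the sum over the zeros that will
be independent of `D`. For this purpose we will use derivatives of (8), which give relations between
the zeros `ρ`, the `Z_j(σ)`, and the derivatives of the digamma function, but do not involve `D`.
First of all, if `ρ` is a non-trivial zero of `ζ_K`, then so are `ρ̄, 1 − ρ`, and `1 − ρ̄`. Thus for
real `σ` we can write `Σ_ρ 1/(σ−ρ) = ½ Σ_ρ (1/(σ−ρ) + 1/(σ−1+ρ̄))` … Suppose now that we can find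
`σ > 1` and … `σ_i > 1`, as well as positive real numbers `a_i` … such that
(11) `E(σ,ρ) ≥ Σ_i a_i E_{k_i}(σ_i,ρ)` holds for all non-trivial zeros `ρ` of `ζ_K`. Then …
(12) `log A ≥ G(σ) + Σ_i a_i(…) − 1/(σ−1) − 1/σ`." And (p. 214): "it was pointed out by
H. M. Stark that in fact it suffices to prove (13) just for `x = 1, y ≥ 0`. To see this, note that
`E` and the `E_j` are harmonic functions of `z` and in the strip `0 ≤ x ≤ 1` they tend uniformly to
`0` as `y → ∞`. Hence by the maximum principle for harmonic functions (13) must hold throughout the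
strip `0 ≤ x ≤ 1, y ≥ 0` if it holds on the boundary of that strip."

This file proves the two abstract steps, for an ARBITRARY entire `F` with `F(1−s) = F(s)`,
`‖F(s)‖ ≤ C exp(‖s‖^μ)` (`μ < 2`) and all zeros in `Re s ≤ 1` (the hypotheses of the tree's Stark
positivity device `Stark1974.re_logDeriv_nonneg_of_symmetric`, which is the special case of a single
point with coefficient `1`), with Odlyzko's derivatives replaced by FINITE LINEAR COMBINATIONS of
values `F'/F(τ_i)` at real points `τ_i > 1` (differences of such values are what derivatives are
limits of; the combination form is what the applications use):

* `Odlyzko1977.finset_sum_mul_re_logDeriv_nonneg` — if real coefficients `c_i` and points `τ_i > 1`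
  satisfy the POINTWISE inequality `Σ_i c_i Re(1/(τ_i − z) + 1/(τ_i − 1 + z)) ≥ 0` for every `z`
  in the closed critical strip `0 ≤ Re z ≤ 1`, then `Σ_i c_i Re F'/F(τ_i) ≥ 0`
  (eqs. (9)–(12): the Hadamard series `F'/F(τ) = Σ_ρ [1/(τ−ρ) + 1/(τ−1+ρ)]` over zero pairs
  `{ρ, 1−ρ}`, summed against the `c_i`, is a convergent series of non-negative terms);
* `Odlyzko1977.re_nonneg_of_re_nonneg_boundary` — Stark's maximum-principle remark: a function
  holomorphic on the closed strip `0 ≤ Re z ≤ 1`, bounded there, whose real part is `≥ 0` on the two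
  boundary lines has real part `≥ 0` on the strip (Phragmén–Lindelöf for `exp(−H)`);
* `Odlyzko1977.finset_sum_mul_re_logDeriv_nonneg_of_boundary` — the two combined: it suffices to
  check the pointwise inequality on the lines `Re z = 0` and `Re z = 1`.

## References

* A. M. Odlyzko, *Lower bounds for discriminants of number fields. II*, Tôhoku Math. J. 29 (1977)
  209–216, eqs. (8)–(13) and p. 214. [Odlyzko1977]
* A. M. Odlyzko, *Lower bounds for discriminants of number fields*, Acta Arith. 29 (1976)
  275–297, §2. [Odlyzko1976]
* H. M. Stark, *Some effective cases of the Brauer–Siegel theorem*, Invent. Math. 23 (1974)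
  135–152, Lemma 3. [Stark1974]
-/

noncomputable section

open Complex Filter Topology Metric Set Asymptotics

namespace Literature.NumberTheory.LFunctions

namespace Odlyzko1977

open Stark1974

/-! ### The zero-sum inequality for finite linear combinations -/

/-- **Odlyzko's zero-sum inequality** ([Odlyzko1977, eqs. (9)–(12)], abstract form). Let `F` be
entire with `F(1 − s) = F(s)`, `‖F(s)‖ ≤ C exp(‖s‖^μ)` for some `0 ≤ μ < 2`, all of whose zeros have
real part `≤ 1`. Let `c_i ∈ ℝ` and `τ_i > 1` (`i ∈ t`, finite) satisfy the pointwise inequality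
`Σ_i c_i Re(1/(τ_i − z) + 1/(τ_i − 1 + z)) ≥ 0` for every `z` with `0 ≤ Re z ≤ 1`. Then
`Σ_i c_i Re F'/F(τ_i) ≥ 0`. (For `t = {i}`, `c_i = 1` this is Stark's `Re F'/F(σ) ≥ 0`.)
[cite: Odlyzko1977, eqs. (8)–(12)] -/
theorem finset_sum_mul_re_logDeriv_nonneg {F : ℂ → ℂ} (hF : Differentiable ℂ F)
    (hsymm : ∀ s, F (1 - s) = F s) {C μ : ℝ} (hμ : μ < 2) (hμ0 : 0 ≤ μ)
    (hgrowth : ∀ s, ‖F s‖ ≤ C * Real.exp (‖s‖ ^ μ)) (hzero : ∀ s, F s = 0 → s.re ≤ 1)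
    {ι : Type*} (t : Finset ι) (c : ι → ℝ) (τ : ι → ℝ) (hτ : ∀ i ∈ t, 1 < τ i)
    (hpt : ∀ z : ℂ, 0 ≤ z.re → z.re ≤ 1 →
      0 ≤ ∑ i ∈ t, c i * (1 / ((τ i : ℂ) - z) + 1 / ((τ i : ℂ) - 1 + z)).re) :
    0 ≤ ∑ i ∈ t, c i * (logDeriv F (τ i)).re := by
  have hFne : ∀ s : ℂ, 1 < s.re → F s ≠ 0 := fun s hs h ↦ by linarith [hzero s h]
  -- the even function `g(z) = F(1/2 + z)`
  set g : ℂ → ℂ := fun z ↦ F (1 / 2 + z) with hg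
  have hg_diff : Differentiable ℂ g := hF.comp ((differentiable_const _).add differentiable_id)
  have hg_even : ∀ z, g (-z) = g z := fun z ↦ by
    simp only [hg]
    rw [← hsymm (1 / 2 + z)]
    congr 1
    ring
  obtain ⟨C₁, hC₁0, hC₁⟩ := growth_shift hμ0 hgrowth (1 / 2) (show μ < (μ + 2) / 2 by linarith)
  -- the even lift `G(w) = g(√w)`
  set G : ℂ → ℂ := fun w ↦ g (w ^ (2⁻¹ : ℂ)) with hGdef
  have hG_diff : Differentiable ℂ G := Newman.differentiable_comp_cpow_half hg_diff hg_even
  have hG_sq : ∀ z, G (z ^ 2) = g z := fun z ↦ Newman.comp_cpow_half_apply_sq hg_even z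
  have hG_growth : ∀ w, ‖G w‖ ≤ C₁ * Real.exp (‖w‖ ^ ((μ + 2) / 4)) := by
    intro w
    have h := hC₁ (w ^ (2⁻¹ : ℂ))
    have hn : ‖w ^ (2⁻¹ : ℂ)‖ = ‖w‖ ^ (2⁻¹ : ℝ) := by
      rw [show (2⁻¹ : ℂ) = ((2⁻¹ : ℝ) : ℂ) by push_cast; ring, Complex.norm_cpow_real]
    rw [hn, ← Real.rpow_mul (norm_nonneg _)] at h
    have he : (2⁻¹ : ℝ) * ((μ + 2) / 2) = (μ + 2) / 4 := by ring
    rwa [he] at h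
  have hρ : (μ + 2) / 4 < 1 := by linarith
  -- `G` is not identically zero
  have hG_ne : G ((3 / 2 : ℂ) ^ 2) ≠ 0 := by
    rw [hG_sq]
    simp only [hg]
    have : (1 / 2 : ℂ) + 3 / 2 = 2 := by norm_num
    rw [this]
    exact hFne 2 (by norm_num)
  obtain ⟨m, G₁, hG₁_diff, hG₁0, hG₁_eq⟩ := exists_eq_pow_mul hG_diff hG_ne
  obtain ⟨C₂, hC₂⟩ := growth_of_eq_pow_mul hG₁_diff hG₁_eq hG_growth
  -- Hadamard's factorisation in genus zero
  obtain ⟨b, hb_sum, hb_prod⟩ :=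
    Literature.Analysis.Complex.hadamard_genus_zero_holds G₁ _ C₂ hG₁_diff hρ hC₂ hG₁0
  set a : ℕ → ℂ := fun n ↦ -b n with ha
  have ha_sum : Summable fun n ↦ ‖a n‖ := by simpa [ha] using hb_sum
  have hprod : ∀ z, HasProd (fun n ↦ 1 + a n * z ^ 2) (G₁ (z ^ 2) / G₁ 0) := fun z ↦ by
    have := hb_prod (z ^ 2)
    simpa [ha, sub_eq_add_neg] using this
  have hg_eq : ∀ z, g z = z ^ (2 * m) * (G₁ 0 * ∏' n, (1 + a n * z ^ 2)) := fun z ↦ by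
    rw [← hG_sq, hG₁_eq, (hprod z).tprod_eq, pow_mul]
    field_simp
  -- every factor-zero is a zero of `F` in the closed strip
  have hroot : ∀ n ζ, a n * ζ ^ 2 = -1 → |ζ.re| ≤ 1 / 2 := by
    intro n ζ hζ
    have hGz : G₁ (ζ ^ 2) = 0 := by
      have h0 : G₁ (ζ ^ 2) / G₁ 0 = 0 :=
        Newman.eq_zero_of_hasProd_of_eq_zero (hprod ζ) (k := n) (by rw [hζ]; ring)
      exact (div_eq_zero_iff.1 h0).resolve_right hG₁0
    have hgζ : ∀ η, η ^ 2 = ζ ^ 2 → g η = 0 := fun η hη ↦ by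
      rw [← hG_sq, hη, hG₁_eq, hGz, mul_zero]
    have h1 := hzero _ (hgζ ζ rfl)
    have h2 := hzero _ (hgζ (-ζ) (by ring))
    simp only [add_re, neg_re] at h1 h2
    norm_num at h1 h2
    rw [abs_le]
    constructor <;> linarith
  have hP_diff : Differentiable ℂ (fun z ↦ ∏' n, (1 + a n * z ^ 2)) :=
    differentiable_tprod_one_add_mul_sq ha_sum
  -- the Hadamard series for `F'/F` at each real point `τ > 1`
  have key : ∀ τ₀ : ℝ, 1 < τ₀ →
      (∀ n, 1 + a n * ((τ₀ : ℂ) - 1 / 2) ^ 2 ≠ 0) ∧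
        logDeriv F τ₀ = 2 * m / ((τ₀ : ℂ) - 1 / 2) +
          ∑' n, 2 * a n * ((τ₀ : ℂ) - 1 / 2) / (1 + a n * ((τ₀ : ℂ) - 1 / 2) ^ 2) := by
    intro τ₀ hτ₀
    set z₀ : ℂ := (τ₀ : ℂ) - 1 / 2 with hz₀
    have hz₀re : z₀.re = τ₀ - 1 / 2 := by simp [hz₀]
    have hz₀0 : z₀ ≠ 0 := by
      intro h
      have := congrArg Complex.re h
      rw [hz₀re, zero_re] at this
      linarith
    have hσz₀ : (1 / 2 : ℂ) + z₀ = τ₀ := by simp [hz₀]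
    have hgz₀ : g z₀ ≠ 0 := by
      simp only [hg]
      rw [hσz₀]
      exact hFne τ₀ (by simpa using hτ₀)
    have hfac : ∀ n, 1 + a n * z₀ ^ 2 ≠ 0 := by
      intro n h
      apply hgz₀
      have h0 : G₁ (z₀ ^ 2) / G₁ 0 = 0 := Newman.eq_zero_of_hasProd_of_eq_zero (hprod z₀) h
      have hGz : G₁ (z₀ ^ 2) = 0 := (div_eq_zero_iff.1 h0).resolve_right hG₁0
      rw [← hG_sq, hG₁_eq, hGz, mul_zero]
    refine ⟨hfac, ?_⟩
    -- `logDeriv F τ₀ = logDeriv g z₀`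
    have hlog1 : logDeriv F τ₀ = logDeriv g z₀ := by
      have hcomp : g = F ∘ fun z ↦ 1 / 2 + z := rfl
      rw [hcomp, logDeriv_comp (by rw [hσz₀]; exact (hF _))
        (((differentiable_const _).add differentiable_id) _), hσz₀]
      have hd : deriv (fun z : ℂ ↦ 1 / 2 + z) z₀ = 1 := by
        rw [deriv_const_add, deriv_id'']
      rw [hd, mul_one]
    have hPz₀ : ∏' n, (1 + a n * z₀ ^ 2) ≠ 0 := tprod_one_add_mul_sq_ne_zero ha_sum hfac
    have hlog2 : logDeriv g z₀ = 2 * m / z₀ + ∑' n, 2 * a n * z₀ / (1 + a n * z₀ ^ 2) := by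
      have hg_fun : g = fun z ↦ z ^ (2 * m) * (G₁ 0 * ∏' n, (1 + a n * z ^ 2)) := funext hg_eq
      rw [hg_fun, logDeriv_mul (f := fun z ↦ z ^ (2 * m))
          (g := fun z ↦ G₁ 0 * ∏' n, (1 + a n * z ^ 2))
          z₀ (pow_ne_zero _ hz₀0) (mul_ne_zero hG₁0 hPz₀) (differentiableAt_pow _)
          ((hP_diff z₀).const_mul _),
        logDeriv_const_mul (f := fun z ↦ ∏' n, (1 + a n * z ^ 2)) z₀ (G₁ 0) hG₁0,
        logDeriv_tprod_one_add_mul_sq ha_sum hfac]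
      have hpow : logDeriv (fun z : ℂ ↦ z ^ (2 * m)) z₀ = 2 * m / z₀ := by
        rw [show (fun z : ℂ ↦ z ^ (2 * m)) = (· ^ (2 * m)) from rfl, logDeriv_pow]
        push_cast
        ring
      rw [hpow]
    rw [hlog1, hlog2]
  -- abbreviations for the series terms and their real parts
  set T : ι → ℕ → ℂ := fun i n ↦
    2 * a n * ((τ i : ℂ) - 1 / 2) / (1 + a n * ((τ i : ℂ) - 1 / 2) ^ 2) with hT
  have hTsum : ∀ i, Summable (T i) := fun i ↦ summable_logDeriv_terms ha_sum _
  have hTre : ∀ i, Summable fun n ↦ c i * (T i n).re := fun i ↦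
    ((hasSum_re (hTsum i).hasSum).summable).mul_left _
  -- real part of `F'/F(τ_i)`
  have hre : ∀ i ∈ t, (logDeriv F (τ i)).re = 2 * m / (τ i - 1 / 2) + ∑' n, (T i n).re := by
    intro i hi
    obtain ⟨-, hld⟩ := key (τ i) (hτ i hi)
    rw [hld, add_re, Complex.re_tsum (hTsum i)]
    congr 1
    have : (2 * (m : ℂ) / ((τ i : ℂ) - 1 / 2)) = ((2 * m / (τ i - 1 / 2) : ℝ) : ℂ) := by
      push_cast; ring
    rw [this, ofReal_re]
  -- the `m`-term is `m ·` (the pointwise combination at `z = 1/2`)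
  have hhalf : ∀ i, (1 / ((τ i : ℂ) - 1 / 2) + 1 / ((τ i : ℂ) - 1 + 1 / 2)).re =
      2 / (τ i - 1 / 2) := by
    intro i
    have : (1 / ((τ i : ℂ) - 1 / 2) + 1 / ((τ i : ℂ) - 1 + 1 / 2)) =
        ((2 / (τ i - 1 / 2) : ℝ) : ℂ) := by
      push_cast
      ring
    rw [this, ofReal_re]
  have hm_nonneg : 0 ≤ (m : ℝ) * ∑ i ∈ t, c i * (2 / (τ i - 1 / 2)) := by
    refine mul_nonneg (Nat.cast_nonneg _) ?_
    have h := hpt (1 / 2) (by norm_num) (by norm_num)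
    simpa only [hhalf] using h
  -- each zero-pair term is the pointwise combination at a point of the closed strip
  have hterm_nonneg : ∀ n, 0 ≤ ∑ i ∈ t, c i * (T i n).re := by
    intro n
    by_cases hn : a n = 0
    · have : ∀ i, T i n = 0 := fun i ↦ by simp [hT, hn]
      simp [this]
    · set ζ : ℂ := (-(a n)⁻¹) ^ (2⁻¹ : ℂ) with hζdef
      have hζ : a n * ζ ^ 2 = -1 := by
        rw [hζdef, cpow_ofNat_inv_pow _ 2]
        field_simp
      have hab := hroot n ζ hζ
      rw [abs_le] at hab
      have hρ0 : 0 ≤ ((1 / 2 : ℂ) + ζ).re := by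
        rw [add_re]; norm_num; linarith [hab.1]
      have hρ1 : ((1 / 2 : ℂ) + ζ).re ≤ 1 := by
        rw [add_re]; norm_num; linarith [hab.2]
      have h := hpt ((1 / 2 : ℂ) + ζ) hρ0 hρ1
      refine le_of_le_of_eq h (Finset.sum_congr rfl fun i hi ↦ ?_)
      obtain ⟨hfac, -⟩ := key (τ i) (hτ i hi)
      congr 2
      rw [show T i n = 2 * a n * ((τ i : ℂ) - 1 / 2) / (1 + a n * ((τ i : ℂ) - 1 / 2) ^ 2)
          from rfl, term_eq_inv_add_inv hζ (hfac n), one_div, one_div]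
      congr 2 <;> ring
  -- assemble
  have hswap : ∑' n, ∑ i ∈ t, c i * (T i n).re = ∑ i ∈ t, c i * ∑' n, (T i n).re := by
    rw [Summable.tsum_finsetSum (fun i _ ↦ hTre i)]
    refine Finset.sum_congr rfl fun i _ ↦ ?_
    exact ((hasSum_re (hTsum i).hasSum).summable).tsum_mul_left _
  have hsum_eq : ∑ i ∈ t, c i * (logDeriv F (τ i)).re =
      (m : ℝ) * ∑ i ∈ t, c i * (2 / (τ i - 1 / 2)) + ∑' n, ∑ i ∈ t, c i * (T i n).re := by
    rw [hswap, Finset.mul_sum, ← Finset.sum_add_distrib]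
    refine Finset.sum_congr rfl fun i hi ↦ ?_
    rw [hre i hi]
    ring
  rw [hsum_eq]
  exact add_nonneg hm_nonneg (tsum_nonneg hterm_nonneg)

/-! ### Stark's maximum-principle remark: the boundary lines suffice -/

/-- **The boundary of the strip suffices** ([Odlyzko1977, p. 214], remark of H. M. Stark): let `H`
be complex differentiable at every point of the closed strip `0 ≤ Re z ≤ 1` and bounded there; if
`Re H ≥ 0` on the lines `Re z = 0` and `Re z = 1`, then `Re H ≥ 0` on the whole closed strip
(maximum principle for the harmonic function `Re H`; here: Phragmén–Lindelöf for `exp(−H)`).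
[cite: Odlyzko1977, p. 214] -/
theorem re_nonneg_of_re_nonneg_boundary {H : ℂ → ℂ}
    (hH : ∀ z : ℂ, 0 ≤ z.re → z.re ≤ 1 → DifferentiableAt ℂ H z)
    {M : ℝ} (hM : ∀ z : ℂ, 0 ≤ z.re → z.re ≤ 1 → ‖H z‖ ≤ M)
    (h0 : ∀ z : ℂ, z.re = 0 → 0 ≤ (H z).re) (h1 : ∀ z : ℂ, z.re = 1 → 0 ≤ (H z).re)
    {z : ℂ} (hz0 : 0 ≤ z.re) (hz1 : z.re ≤ 1) : 0 ≤ (H z).re := by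
  set f : ℂ → ℂ := fun w ↦ exp (-H w) with hf
  have hclosure : closure (re ⁻¹' Ioo (0 : ℝ) 1) = re ⁻¹' Icc (0 : ℝ) 1 := by
    rw [closure_preimage_re, closure_Ioo zero_ne_one]
  have hfd : DiffContOnCl ℂ f (re ⁻¹' Ioo (0 : ℝ) 1) := by
    refine ⟨fun w hw ↦ ?_, fun w hw ↦ ?_⟩
    · exact ((hH w hw.1.le hw.2.le).neg.cexp).differentiableWithinAt
    · rw [hclosure] at hw
      exact ((hH w hw.1 hw.2).neg.cexp).continuousAt.continuousWithinAt
  have hnorm : ∀ w : ℂ, ‖f w‖ = Real.exp (-(H w).re) := fun w ↦ by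
    rw [hf, Complex.norm_exp, neg_re]
  have hB : ∃ c < Real.pi / (1 - 0), ∃ B,
      f =O[comap (_root_.abs ∘ im) atTop ⊓ 𝓟 (re ⁻¹' Ioo (0 : ℝ) 1)]
        fun z ↦ Real.exp (B * Real.exp (c * |z.im|)) := by
    refine ⟨0, by simpa using Real.pi_pos, M, ?_⟩
    refine IsBigO.of_bound 1 ?_
    refine eventually_inf_principal.2 (Eventually.of_forall fun w hw ↦ ?_)
    have hw' : 0 ≤ w.re ∧ w.re ≤ 1 := ⟨hw.1.le, hw.2.le⟩
    rw [hnorm, zero_mul, Real.exp_zero, mul_one, one_mul, Real.norm_eq_abs,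
      abs_of_pos (Real.exp_pos _)]
    refine Real.exp_le_exp.2 ?_
    calc -(H w).re ≤ |(H w).re| := neg_le_abs _
      _ ≤ ‖H w‖ := abs_re_le_norm _
      _ ≤ M := hM w hw'.1 hw'.2
  have hle : ∀ w : ℂ, (w.re = 0 ∨ w.re = 1) → ‖f w‖ ≤ 1 := by
    intro w hw
    rw [hnorm, Real.exp_le_one_iff, neg_nonpos]
    rcases hw with hw | hw
    · exact h0 w hw
    · exact h1 w hw
  have h := PhragmenLindelof.vertical_strip hfd hB (fun w hw ↦ hle w (Or.inl hw))
    (fun w hw ↦ hle w (Or.inr hw)) hz0 hz1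
  rwa [hnorm, Real.exp_le_one_iff, neg_nonpos] at h

/-- The pointwise kernel `Σ_i c_i (1/(τ_i − z) + 1/(τ_i − 1 + z))` is complex differentiable at
every point of the closed strip `0 ≤ Re z ≤ 1` when all `τ_i > 1`. [folklore] -/
private theorem differentiableAt_kernel {ι : Type*} (t : Finset ι) (c : ι → ℝ) (τ : ι → ℝ)
    (hτ : ∀ i ∈ t, 1 < τ i) {z : ℂ} (hz0 : 0 ≤ z.re) (hz1 : z.re ≤ 1) :
    DifferentiableAt ℂ
      (fun w : ℂ ↦ ∑ i ∈ t, (c i : ℂ) * (1 / ((τ i : ℂ) - w) + 1 / ((τ i : ℂ) - 1 + w))) z := by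
  refine DifferentiableAt.fun_sum fun i hi ↦ ?_
  have h1 : (τ i : ℂ) - z ≠ 0 := by
    intro h
    have := congrArg Complex.re h
    simp at this
    linarith [hτ i hi]
  have h2 : (τ i : ℂ) - 1 + z ≠ 0 := by
    intro h
    have := congrArg Complex.re h
    simp at this
    linarith [hτ i hi]
  refine DifferentiableAt.const_mul (DifferentiableAt.add ?_ ?_) _
  · simp only [one_div]
    exact ((differentiableAt_const _).sub differentiableAt_id).inv h1
  · simp only [one_div]
    exact (((differentiableAt_const _).sub (differentiableAt_const _)).add
      differentiableAt_id).inv h2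

/-- The pointwise kernel is bounded on the closed strip: each term has norm at most
`1/(τ_i − 1) + 1/(τ_i − 1)`. [folklore] -/
private theorem norm_kernel_le {ι : Type*} (t : Finset ι) (c : ι → ℝ) (τ : ι → ℝ)
    (hτ : ∀ i ∈ t, 1 < τ i) {z : ℂ} (hz0 : 0 ≤ z.re) (hz1 : z.re ≤ 1) :
    ‖∑ i ∈ t, (c i : ℂ) * (1 / ((τ i : ℂ) - z) + 1 / ((τ i : ℂ) - 1 + z))‖ ≤
      ∑ i ∈ t, |c i| * (2 / (τ i - 1)) := by
  refine (norm_sum_le _ _).trans (Finset.sum_le_sum fun i hi ↦ ?_)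
  have hτi := hτ i hi
  rw [norm_mul, Complex.norm_real, Real.norm_eq_abs]
  refine mul_le_mul_of_nonneg_left ?_ (abs_nonneg _)
  have hb1 : τ i - 1 ≤ ‖(τ i : ℂ) - z‖ := by
    calc τ i - 1 ≤ ((τ i : ℂ) - z).re := by simp; linarith
      _ ≤ ‖(τ i : ℂ) - z‖ := re_le_norm _
  have hb2 : τ i - 1 ≤ ‖(τ i : ℂ) - 1 + z‖ := by
    calc τ i - 1 ≤ ((τ i : ℂ) - 1 + z).re := by simp; linarith
      _ ≤ ‖(τ i : ℂ) - 1 + z‖ := re_le_norm _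
  have hpos : 0 < τ i - 1 := by linarith
  calc ‖1 / ((τ i : ℂ) - z) + 1 / ((τ i : ℂ) - 1 + z)‖
      ≤ ‖1 / ((τ i : ℂ) - z)‖ + ‖1 / ((τ i : ℂ) - 1 + z)‖ := norm_add_le _ _
    _ ≤ 1 / (τ i - 1) + 1 / (τ i - 1) := by
        rw [norm_div, norm_div, norm_one]
        gcongr
    _ = 2 / (τ i - 1) := by ring

/-- **Odlyzko's zero-sum inequality, boundary form** ([Odlyzko1977, (11)–(13) with Stark's remark,
p. 214]): under the hypotheses of `finset_sum_mul_re_logDeriv_nonneg` on `F`, if the pointwise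
inequality `Σ_i c_i Re(1/(τ_i − z) + 1/(τ_i − 1 + z)) ≥ 0` holds on the two lines `Re z = 0` and
`Re z = 1`, then `Σ_i c_i Re F'/F(τ_i) ≥ 0`. [cite: Odlyzko1977, eqs. (11)–(13), p. 214] -/
theorem finset_sum_mul_re_logDeriv_nonneg_of_boundary {F : ℂ → ℂ} (hF : Differentiable ℂ F)
    (hsymm : ∀ s, F (1 - s) = F s) {C μ : ℝ} (hμ : μ < 2) (hμ0 : 0 ≤ μ)
    (hgrowth : ∀ s, ‖F s‖ ≤ C * Real.exp (‖s‖ ^ μ)) (hzero : ∀ s, F s = 0 → s.re ≤ 1)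
    {ι : Type*} (t : Finset ι) (c : ι → ℝ) (τ : ι → ℝ) (hτ : ∀ i ∈ t, 1 < τ i)
    (hbd : ∀ z : ℂ, (z.re = 0 ∨ z.re = 1) →
      0 ≤ ∑ i ∈ t, c i * (1 / ((τ i : ℂ) - z) + 1 / ((τ i : ℂ) - 1 + z)).re) :
    0 ≤ ∑ i ∈ t, c i * (logDeriv F (τ i)).re := by
  set H : ℂ → ℂ := fun w ↦ ∑ i ∈ t, (c i : ℂ) * (1 / ((τ i : ℂ) - w) + 1 / ((τ i : ℂ) - 1 + w))
    with hHdef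
  have hHre : ∀ w, (H w).re =
      ∑ i ∈ t, c i * (1 / ((τ i : ℂ) - w) + 1 / ((τ i : ℂ) - 1 + w)).re := by
    intro w
    rw [hHdef, Complex.re_sum]
    refine Finset.sum_congr rfl fun i _ ↦ ?_
    rw [re_ofReal_mul]
  refine finset_sum_mul_re_logDeriv_nonneg hF hsymm hμ hμ0 hgrowth hzero t c τ hτ ?_
  intro z hz0 hz1
  rw [← hHre]
  exact re_nonneg_of_re_nonneg_boundary (H := H)
    (fun w hw0 hw1 ↦ differentiableAt_kernel t c τ hτ hw0 hw1)
    (fun w hw0 hw1 ↦ norm_kernel_le t c τ hτ hw0 hw1)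
    (fun w hw ↦ by rw [hHre]; exact hbd w (Or.inl hw))
    (fun w hw ↦ by rw [hHre]; exact hbd w (Or.inr hw)) hz0 hz1

end Odlyzko1977

end Literature.NumberTheory.LFunctions
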